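import Summits.QuantumAdvantage.AdviceFreeQNC0.AffBells22WalkHardAllSubcube
import Summits.QuantumAdvantage.AdviceFreeQNC0.WindowLocalHard
import Summits.QuantumAdvantage.AdviceFreeQNC0.WalkTransport
import HarnessLib

/-!
# Cell qa-qnc0 — P-37c (c1): the BLOCK-FIBRE LAW (1/2): blocks and the walk exponent on the fibre

Cell qa-qnc0, crux stmt-QuantumAdvantage-22907.  AUTHORED AND PROVED BY THE PLANNER qa-qnc0-p1 gen 37 (P-37c (c1), INBOX P1-37c 14:53Z, evidence #58/#60 on stmt-22907, file `HOME/qa-qnc0-p1/exp37/BlockFibreLaw37.lean`, 596 lines, sha bb88df9c8e7f5626, rc 0 / 0 sorries); landed verbatim by qn-prover-3 g21 as a two-way split: `BlockFibre37Blocks` (§§0–2: typed targets `BlockFam`/`InBlock`/`bwt`/`Admissible`/`blockExt`/`BlockFibreLaw`, blocks, the walk exponent on the fibre mod 3) → `BlockFibreLaw37` (§§3–5: module membership, counting, normalisation, `blockFibreLaw : BlockFibreLaw`).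
-/

noncomputable section

open Classical

namespace Summit.QuantumAdvantage.AdviceFreeQNC0

open Finset
open Literature.Computability.MetaComplexity Literature.Computability.MetaComplexity.Smolensky
open F4 AffBells22 Subcube

namespace BlockFibre37

variable {n m : ℕ}

/-! ### 0. The typed targets (verbatim from exp36/BlockFibre37.lean) -/

/-- a family of `m` disjoint blocks of walk-bit positions, increasing, inside `[1, n]`, consecutive blocks at least `2` apart
(so the bits `u_{st−1} … u_{st+len}` read by the admissibility / relation conditions of distinct blocks are disjoint). -/
structure BlockFam (n m : ℕ) where
  st : Fin m → ℕ
  len : Fin m → ℕ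
  len_pos : ∀ j, 1 ≤ len j
  one_le : ∀ j, 1 ≤ st j
  le_n : ∀ j, st j + len j ≤ n
  sep : ∀ j j' : Fin m, j < j' → st j + len j + 2 ≤ st j'

/-- `i` lies in block `j`. -/
def InBlock (B : BlockFam n m) (j : Fin m) (i : Fin n) : Prop := B.st j ≤ i.val ∧ i.val < B.st j + B.len j

/-- block weight `len j + #{i ∈ block j : a_i = 1}` (≡ #zeros − #ones of `a` on the block, mod 3). -/
def bwt (B : BlockFam n m) (a : Fin n → Bool) (j : Fin m) : ℕ :=
  B.len j + (univ.filter fun i : Fin n => InBlock B j i ∧ a i = true).card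

/-- block `j` is admissible for `a`: complementing it moves the hidden trit (`len − 2·#ones ≢ 0 (mod 3)`). -/
def Admissible (B : BlockFam n m) (a : Fin n → Bool) (j : Fin m) : Prop := bwt B a j % 3 ≠ 0

/-- the point of the block fibre of `a` with parameter `v`: block `j` is complemented iff `v j`. -/
def blockExt (B : BlockFam n m) (a : Fin n → Bool) (v : Fin m → Bool) : Fin n → Bool := fun i =>
  xor (a i) (decide (∃ j : Fin m, InBlock B j i ∧ v j = true))

/-- **(c1) THE BLOCK-FIBRE LAW** (target). -/
def BlockFibreLaw : Prop :=
  ∃ θ : ℝ, θ < 1 ∧ ∃ m₀ : ℕ, ∀ (n m : ℕ) (B : BlockFam n m), m₀ ≤ m → ∀ (a : Fin n → Bool), (∀ j, Admissible B a j) →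
    ∀ (D : ℕ), D + 1 ≤ Nat.sqrt m → ∀ (c : ℕ) (y : Fin (n + 1) → (Fin n → Bool) → Bool),
      (∀ g, HasDeg (fun v => y g (blockExt B a v)) D) →
        ((univ.filter fun v : Fin m → Bool => ringWinU c y (blockExt B a v) = true).card : ℝ) ≤ θ * (2 : ℝ) ^ m

/-- outside all blocks the fibre point is the background. -/
theorem blockExt_of_not_inBlock (B : BlockFam n m) (a : Fin n → Bool) (v : Fin m → Bool) {i : Fin n}
    (h : ∀ j, ¬ InBlock B j i) : blockExt B a v i = a i := by
  unfold blockExt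
  have : ¬ ∃ j : Fin m, InBlock B j i ∧ v j = true := fun ⟨j, hj, _⟩ => h j hj
  rw [decide_eq_false this]
  cases a i <;> rfl

/-! ### 1. Blocks -/

/-- a position lies in at most one block. -/
theorem inBlock_unique (B : BlockFam n m) {j j' : Fin m} {i : Fin n} (h : InBlock B j i) (h' : InBlock B j' i) :
    j = j' := by
  unfold InBlock at h h'
  by_contra hne
  rcases lt_or_gt_of_ne hne with hlt | hlt
  · have := B.sep j j' hlt; omega
  · have := B.sep j' j hlt; omega

/-- inside block `j` the fibre point is `a_i ⊕ v_j`. -/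
theorem blockExt_of_inBlock (B : BlockFam n m) (a : Fin n → Bool) (v : Fin m → Bool) {j : Fin m} {i : Fin n}
    (h : InBlock B j i) : blockExt B a v i = xor (a i) (v j) := by
  unfold blockExt
  have e : decide (∃ j' : Fin m, InBlock B j' i ∧ v j' = true) = v j := by
    cases hv : v j
    · exact decide_eq_false fun ⟨j', hj', hv'⟩ => by
        rw [inBlock_unique B hj' h, hv] at hv'
        exact Bool.false_ne_true hv'
    · exact decide_eq_true ⟨j, h, hv⟩
  rw [e]

/-- the block as a finset. -/
def blk (B : BlockFam n m) (j : Fin m) : Finset (Fin n) := univ.filter fun i => InBlock B j i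

/-- a block has `len j` positions. -/
theorem card_blk (B : BlockFam n m) (j : Fin m) : (blk B j).card = B.len j := by
  unfold blk
  refine Finset.card_eq_of_bijective (fun k hk => ⟨B.st j + k, by have := B.le_n j; omega⟩) ?_ ?_ ?_
  · intro i hi
    rw [mem_filter] at hi
    have h := hi.2
    unfold InBlock at h
    exact ⟨i.val - B.st j, by omega, by ext; simp only; omega⟩
  · intro k hk
    rw [mem_filter]
    refine ⟨mem_univ _, ?_⟩
    unfold InBlock
    simp only
    omega
  · intro k l hk hl hkl
    have := congrArg Fin.val hkl
    simp only at this
    omega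

/-- `Σ_{i ∈ block j} (1 + [a_i]) = bwt`. -/
theorem sum_blk_lett (B : BlockFam n m) (a : Fin n → Bool) (j : Fin m) :
    ∑ i ∈ blk B j, (if a i = true then 2 else 1) = bwt B a j := by
  have e : ∀ i : Fin n, (if a i = true then 2 else 1 : ℕ) = 1 + (if a i = true then 1 else 0) := by
    intro i; split_ifs <;> rfl
  simp_rw [e]
  rw [sum_add_distrib, sum_const, smul_eq_mul, mul_one, ← card_filter, card_blk]
  unfold bwt blk
  rw [filter_filter]

/-! ### 2. The walk exponent on the fibre (mod 3) -/

/-- the coefficient `1 + [i < g]` of walk bit `i` in player `g`'s exponent. -/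
def cw (g : ℕ) (i : Fin n) : ℕ := if i.val < g then 2 else 1

/-- `walkExp v g = Σ_i [v_i]·(1 + [i < g])`. -/
theorem walkExp_eq_sum (v : Fin n → Bool) (g : ℕ) :
    walkExp v g = ∑ i : Fin n, if v i = true then cw g i else 0 := by
  unfold walkExp wt wtPrefix
  rw [card_filter, card_filter, ← sum_add_distrib]
  refine sum_congr rfl fun i _ => ?_
  unfold cw
  by_cases hv : v i = true <;> by_cases hi : i.val < g <;> simp [hv, hi]

/-- `μ_{g,j} = Σ_{i ∈ block j} (1 + [i < g])·(1 + [a_i])`. -/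
def mu (B : BlockFam n m) (a : Fin n → Bool) (g : ℕ) (j : Fin m) : ℕ :=
  ∑ i ∈ blk B j, cw g i * (if a i = true then 2 else 1)

/-- **additive split**: `walkExp (blockExt B a w) g ≡ walkExp a g + Σ_j [w_j] μ_{g,j} (mod 3)`. -/
theorem walkExp_blockExt_mod (B : BlockFam n m) (a : Fin n → Bool) (w : Fin m → Bool) (g : ℕ) :
    walkExp (blockExt B a w) g % 3 = (walkExp a g + ∑ j, if w j = true then mu B a g j else 0) % 3 := by
  rw [walkExp_eq_sum, walkExp_eq_sum]
  have key : ∀ i : Fin n, (if blockExt B a w i = true then cw g i else 0) % 3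
      = ((if a i = true then cw g i else 0)
          + ∑ j : Fin m, if (InBlock B j i ∧ w j = true) then cw g i * (if a i = true then 2 else 1) else 0) % 3 := by
    intro i
    by_cases hex : ∃ j, InBlock B j i ∧ w j = true
    · obtain ⟨j, hj, hw⟩ := hex
      rw [Finset.sum_eq_single j]
      · rw [if_pos (show InBlock B j i ∧ w j = true from ⟨hj, hw⟩), blockExt_of_inBlock B a w hj, hw]
        unfold cw
        cases a i <;> by_cases hi : i.val < g <;> simp [hi]
      · intro j' _ hne
        rw [if_neg]
        rintro ⟨hj', _⟩
        exact hne (inBlock_unique B hj' hj)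
      · intro h; exact absurd (mem_univ j) h
    · have e1 : blockExt B a w i = a i := by
        unfold blockExt; rw [decide_eq_false hex]; cases a i <;> rfl
      rw [e1, Finset.sum_eq_zero, add_zero]
      intro j _
      rw [if_neg]
      rintro ⟨hj, hw⟩
      exact hex ⟨j, hj, hw⟩
  have e2 : ∑ i : Fin n, ∑ j : Fin m, (if (InBlock B j i ∧ w j = true) then cw g i * (if a i = true then 2 else 1) else 0)
      = ∑ j, if w j = true then mu B a g j else 0 := by
    rw [Finset.sum_comm]
    refine sum_congr rfl fun j _ => ?_
    by_cases hw : w j = true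
    · rw [if_pos hw]
      unfold mu blk
      rw [sum_filter]
      refine sum_congr rfl fun i _ => ?_
      by_cases hji : InBlock B j i
      · rw [if_pos ⟨hji, hw⟩, if_pos hji]
      · rw [if_neg fun h => hji h.1, if_neg hji]
    · rw [if_neg hw]
      refine sum_eq_zero fun i _ => ?_
      rw [if_neg fun h => hw h.2]
  rw [Finset.sum_nat_mod, Finset.sum_congr rfl fun i _ => key i, ← Finset.sum_nat_mod, sum_add_distrib, e2]

/-- block `j` lies entirely before player `g`. -/
def Before (B : BlockFam n m) (g : ℕ) (j : Fin m) : Prop := B.st j + B.len j ≤ g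

/-- `h_g = #{blocks before g}`. -/
def hIdx (B : BlockFam n m) (g : ℕ) : ℕ := (univ.filter fun j => Before B g j).card

/-- block `j` is straddled by `g`. -/
def Strad (B : BlockFam n m) (g : ℕ) (j : Fin m) : Prop := B.st j < g ∧ g < B.st j + B.len j

/-- `Before` is downward closed in the block index. -/
theorem before_of_le (B : BlockFam n m) {g : ℕ} {j j' : Fin m} (hjj : j ≤ j') (h : Before B g j') :
    Before B g j := by
  unfold Before at *
  rcases hjj.eq_or_lt with heq | hlt
  · rw [heq]; exact h
  · have := B.sep j j' hlt; omega

/-- the blocks before `g` form the initial segment `j < h_g`. -/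
theorem before_iff (B : BlockFam n m) (g : ℕ) (j : Fin m) : Before B g j ↔ j.val < hIdx B g := by
  unfold hIdx
  constructor
  · intro h
    have hsub : Finset.Iic j ⊆ univ.filter fun j' => Before B g j' := by
      intro j' hj'
      rw [Finset.mem_Iic] at hj'
      rw [mem_filter]
      exact ⟨mem_univ _, before_of_le B hj' h⟩
    have := card_le_card hsub
    rw [Fin.card_Iic] at this
    omega
  · intro h
    by_contra hne
    have hsub : (univ.filter fun j' => Before B g j') ⊆ Finset.Iio j := by
      intro j' hj'
      rw [mem_filter] at hj'
      rw [Finset.mem_Iio]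
      by_contra hle
      push Not at hle
      exact hne (before_of_le B hle hj'.2)
    have := card_le_card hsub
    rw [Fin.card_Iio] at this
    omega

/-- a straddled block is block number `h_g`. -/
theorem hIdx_eq_of_strad (B : BlockFam n m) {g : ℕ} {j₀ : Fin m} (h : Strad B g j₀) : hIdx B g = j₀.val := by
  unfold hIdx
  unfold Strad at h
  have e : (univ.filter fun j => Before B g j) = Finset.Iio j₀ := by
    ext j
    rw [mem_filter, Finset.mem_Iio]
    unfold Before
    constructor
    · rintro ⟨_, hb⟩
      by_contra hle
      push Not at hle
      rcases hle.eq_or_lt with heq | hlt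
      · rw [heq] at h; omega
      · have := B.sep j₀ j hlt; omega
    · intro hlt
      exact ⟨mem_univ _, by have := B.sep j j₀ hlt; omega⟩
  rw [e, Fin.card_Iio]

/-- at most one block is straddled. -/
theorem strad_unique (B : BlockFam n m) {g : ℕ} {j j' : Fin m} (h : Strad B g j) (h' : Strad B g j') : j = j' := by
  have h1 := hIdx_eq_of_strad B h
  have h2 := hIdx_eq_of_strad B h'
  exact Fin.ext (by omega)

/-- a normalised block not straddled by `g`: `μ_{g,j} ≡ 1 + [before] (mod 3)`. -/
theorem mu_mod_of_not_strad (B : BlockFam n m) (a : Fin n → Bool) {g : ℕ} {j : Fin m}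
    (hn : bwt B a j % 3 = 1) (hs : ¬ Strad B g j) :
    mu B a g j % 3 = if Before B g j then 2 else 1 := by
  unfold Strad at hs
  by_cases hb : Before B g j
  · rw [if_pos hb]
    have e : mu B a g j = 2 * bwt B a j := by
      unfold mu
      rw [← sum_blk_lett, mul_sum]
      refine sum_congr rfl fun i hi => ?_
      unfold blk at hi
      rw [mem_filter] at hi
      have h2 := hi.2
      unfold InBlock at h2
      unfold Before at hb
      unfold cw
      rw [if_pos (by omega)]
    rw [e]; omega
  · rw [if_neg hb]
    unfold Before at hb
    have hg : g ≤ B.st j := by omega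
    have e : mu B a g j = bwt B a j := by
      unfold mu
      rw [← sum_blk_lett]
      refine sum_congr rfl fun i hi => ?_
      unfold blk at hi
      rw [mem_filter] at hi
      have h2 := hi.2
      unfold InBlock at h2
      unfold cw
      rw [if_neg (by omega), one_mul]
    rw [e]; exact hn

/-- the straddle correction `δ_g(w) = [w_{j₀}]·(μ_{g,j₀} + 2)` (a sum with at most one non-zero term). -/
def delta (B : BlockFam n m) (a : Fin n → Bool) (g : ℕ) (w : Fin m → Bool) : ℕ :=
  ∑ j, if Strad B g j then (if w j = true then mu B a g j + 2 else 0) else 0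

/-- If no block is straddled by `g`, the fibre correction `delta` vanishes. -/
theorem delta_of_not_exists (B : BlockFam n m) (a : Fin n → Bool) {g : ℕ} (h : ¬ ∃ j, Strad B g j)
    (w : Fin m → Bool) : delta B a g w = 0 := by
  unfold delta
  refine sum_eq_zero fun j _ => ?_
  rw [if_neg fun hj => h ⟨j, hj⟩]

/-- If block `j₀` is straddled by `g`, `delta` depends on the single coordinate `w j₀`. -/
theorem delta_of_strad (B : BlockFam n m) (a : Fin n → Bool) {g : ℕ} {j₀ : Fin m} (h : Strad B g j₀)
    (w : Fin m → Bool) : delta B a g w = if w j₀ = true then mu B a g j₀ + 2 else 0 := by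
  unfold delta
  rw [Finset.sum_eq_single j₀]
  · rw [if_pos h]
  · intro j _ hne
    rw [if_neg fun hj => hne (strad_unique B hj h)]
  · intro hj; exact absurd (mem_univ _) hj

/-- **normalised split**: `Σ_j [w_j] μ_{g,j} ≡ walkExp w h_g + δ_g(w) (mod 3)`. -/
theorem sum_mu_mod (B : BlockFam n m) (a : Fin n → Bool) (ha : ∀ j, bwt B a j % 3 = 1) (g : ℕ)
    (w : Fin m → Bool) :
    (∑ j, if w j = true then mu B a g j else 0) % 3 = (walkExp w (hIdx B g) + delta B a g w) % 3 := by
  rw [walkExp_eq_sum]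
  unfold delta
  rw [← sum_add_distrib, Finset.sum_nat_mod]
  conv_rhs => rw [Finset.sum_nat_mod]
  refine congrArg (· % 3) (sum_congr rfl fun j _ => ?_)
  by_cases hs : Strad B g j
  · rw [if_pos hs]
    have hc : cw (hIdx B g) j = 1 := by
      unfold cw; rw [hIdx_eq_of_strad B hs, if_neg (lt_irrefl _)]
    rw [hc]
    by_cases hw : w j = true
    · rw [if_pos hw, if_pos hw, if_pos hw]; omega
    · rw [if_neg hw, if_neg hw, if_neg hw]
  · rw [if_neg hs, add_zero]
    by_cases hw : w j = true
    · rw [if_pos hw, if_pos hw, mu_mod_of_not_strad B a (ha j) hs]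
      unfold cw
      by_cases hb : Before B g j
      · rw [if_pos hb, if_pos ((before_iff B g j).1 hb)]
      · rw [if_neg hb, if_neg (mt (before_iff B g j).2 hb)]
    · rw [if_neg hw, if_neg hw]

end BlockFibre37

end Summit.QuantumAdvantage.AdviceFreeQNC0
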